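import Summits.Langlands.Langlands.Theorems.IrreducibilityBySelfDualityPairLBoundaryJS
import Summits.Langlands.Langlands.Theorems.IrreducibilityBySelfDualityPairLBoundaryJSSsv
import Summits.Langlands.Langlands.Theorems.IrreducibilityBySelfDualityPairLBoundaryJSStandardEntire
import Summits.Langlands.Langlands.Theorems.IrreducibilityBySelfDualityPairLBoundaryJSIsOrthoOfLocalTranslate
import Summits.Langlands.Langlands.Theorems.IrreducibilityBySelfDualityPairLBoundaryJSEqConjOfLocalTranslate
import Summits.Langlands.Langlands.Theorems.IrreducibilityBySelfDualityPairLBoundaryJSLocalPairTranslate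
import Summits.Langlands.Langlands.Theorems.IrreducibilityBySelfDualityPairLBoundaryJSOfHumphriesJo
import Summits.Langlands.Langlands.Theorems.IrreducibilityBySelfDualityPairLBoundaryJSCornerBochnerIwasawa
import Summits.Langlands.Langlands.Theorems.IrreducibilityBySelfDualityPairLBoundaryJSCornerPairTranslate
import Summits.Langlands.Langlands.Theorems.IrreducibilityBySelfDualityPairLBoundaryJSCornerPairEuler
import Summits.Langlands.Langlands.Theorems.IrreducibilityBySelfDualityPairLBoundaryJSCornerAbsMajorant
import Summits.Langlands.Langlands.Theorems.IrreducibilityBySelfDualityPairLBoundaryJSCornerAbsIdeleMoment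
import Literature.NumberTheory.Automorphic.PairLFunctionMeromorphicContinuationRankNeTwistProofs
import Literature.NumberTheory.Automorphic.ArchRankinSelbergTestVector
import Literature.NumberTheory.Automorphic.JPSSGlobalIntegralQuotientUnfolding
import Literature.NumberTheory.Automorphic.JPSSCornerWhittakerUnfolding
import Literature.NumberTheory.Automorphic.WhittakerPeriodExchange
import Literature.NumberTheory.Automorphic.TorusIwasawaTransport
import Literature.NumberTheory.Automorphic.CornerTorusIwasawaData
import Literature.NumberTheory.Automorphic.WhittakerCoeffHonestCuspForm
import Literature.NumberTheory.Automorphic.WhittakerCoeffTranslateUnramified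
import Literature.NumberTheory.Automorphic.WhittakerDecayCuspForm
import Literature.NumberTheory.Automorphic.WhittakerSupportFinite
import Literature.NumberTheory.Automorphic.RankinSelbergUnramifiedTorus
import Literature.NumberTheory.Automorphic.RankinSelbergTorusPairEuler
import Literature.NumberTheory.Automorphic.RankinSelbergTowerFiniteness

/-!
# The Euler factorisation of the unfolded `GL_{m+1} × GL_m` corner integral over ALL good places

Summit `Langlands`, sub-problem `Langlands`, helper file under `Theorems/` supporting the crux
`PairLBoundaryJS` (stmt-Langlands-13622), line `Sketch`, registered stub `stub_corner_euler_limit` (W-EL):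
the CORNER analogue of `rankinSelbergTorusPairIntegralC_eq_mul_setIntegral_of_hasProd`
(`RankinSelbergTorusPairEuler`, §Limit). For continuous `W` on `GL_{m+1}(𝔸_K)` (`‖W‖` central-invariant)
and `W'` on `GL_m(𝔸_K)`, unramified Whittaker–Hecke torus data at every `v ∉ S'` with parameters
`x_v ∈ ℂ^{m+1}`, `y_v ∈ ℂ^m` bounded by `q_v^{1/2}` and enumerating the multisets `α_v`, `β_v`, `re s > 1/2`,
the corner pair integrand `I_s(a, k) = W(diag(diag(a) k, 1)) W'(diag(a) k) |det a|^s δ_{B_m}(a)⁻¹` integrable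
and `L` the product of the unramified local factors `P_{α_v, β_v}(q_v^{-(s+1/2)})⁻¹` over `v ∉ S'`:

  `∫ I_s = L · ∫_{B({v ∉ S'}) × K} I_s`   (`stub_corner_euler_limit`)

(Cogdell (2004), Thm. 2.2 with Thm. 3.3; Jacquet–Shalika (1981), §2 Prop. (2.3), §4): the landed finite
factorisation `CornerPairEuler.stub_corner_euler` over the finite subsets `F` of `{v ∉ S'}`
(`prod_inv_eval_satakePairPolynomial_mul_setIntegral_image_eq`), then the limit along `F → {v ∉ S'}`
(`tendsto_setIntegral_unitBox_image_pair` for the box integrals, the hypothesis `HasProd … L` for the finite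
products, uniqueness of limits).

## References

* J. W. Cogdell, *Analytic theory of L-functions for GL_n*, in *An Introduction to the Langlands
  Program* (2004), §2.3 Thm. 2.2, §3 Thm. 3.3 [CogdellAnalyticTheory2004].
* H. Jacquet, J. A. Shalika, *On Euler products and the classification of automorphic
  representations I*, Amer. J. Math. 103 (1981), §2 Prop. (2.3), §4 [JacquetShalikaAJM1981].
-/

noncomputable section

-- `Summit.Langlands.Langlands.…` (summit = sub-problem name, D-0017 layout) trips `dupNamespace`
set_option linter.dupNamespace false

open scoped MatrixGroups Topology Pointwise ENNReal NNReal ComplexConjugate InnerProductSpace ContDiff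
-- the place subtypes indexing `mixedSpace K` are `Fintype` classically (`NormedCommRing (mixedSpace K)`)
open scoped Classical Matrix.Norms.Operator
open NumberField IsDedekindDomain MeasureTheory Measure Matrix Set Filter WithZero
open NumberField.mixedEmbedding
open Literature.NumberTheory.Automorphic AdelicGroupData
open Literature.NumberTheory.GaloisRepresentations (ideleGroup HeckeCharacter)
open Literature.MeasureTheory.Group
open Literature.RingTheory.SymmetricFunctions.SymmPoly
open ValuativeRel

-- the automorphic quotient carries the tree's Borel σ-algebra, not Mathlib's quotient σ-algebra
attribute [-instance] Quotient.instMeasurableSpace QuotientGroup.measurableSpace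

-- the house local instances, exactly as in `RankinSelbergUnfoldingIdentity`
attribute [local instance] adelicBorel borelSpace_adelic locallyCompactSpace_adelic secondCountableTopology_gl_adelic
  glAdeleBorel borelSpace_glAdele borelSpace_ideleGroup secondCountableTopology_ideleGroup

-- Mathlib idiom: the commutator Lie ring on matrices, to mention `(archGroupGL n K).lie`
attribute [local instance 100] LieRing.ofAssociativeRing

namespace Summit.Langlands.Langlands.Theorems.CornerEulerLimit

variable {m : ℕ} {K : Type} [Field K] [NumberField K]
  [MeasurableSpace (AdeleRing (𝓞 K) K)] [BorelSpace (AdeleRing (𝓞 K) K)]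

/-! ### The finite factorisation over the image of a finite set of good places -/

/-- **The finite Euler factorisation along the finite subsets of `{v ∉ S'}`**: for a finite set `F` of
places OFF `S'` (a `Finset` of the subtype, embedded by `Subtype.val`), with the hypotheses of
`stub_corner_euler_limit` (unramified data, bounds and enumerations `α_v`, `β_v` at every `v ∉ S'`),
`(∏_{u ∈ F} P_{α_u, β_u}(q_u^{-(s+1/2)})⁻¹) · ∫_{B(F) × K} I_s = ∫ I_s` — the landed
`CornerPairEuler.stub_corner_euler` at `F.map Subtype.val`, the product re-indexed by `Finset.prod_map` and the
local factors rewritten through the enumerations. [cite: CogdellAnalyticTheory2004, Thm. 2.2, Thm. 3.3] -/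
theorem prod_inv_eval_satakePairPolynomial_mul_setIntegral_image_eq (hm : 0 < m)
    (νA : Measure (Fin m → ideleGroup K)) [IsHaarMeasure νA]
    (νK : Measure ↥(maximalCompactAdelic m K)) [IsHaarMeasure νK]
    {W : GL (Fin (m + 1)) (AdeleRing (𝓞 K) K) → ℂ} {W' : GL (Fin m) (AdeleRing (𝓞 K) K) → ℂ}
    (hWc : Continuous W) (hW'c : Continuous W')
    (hWZ : ∀ (z : ideleGroup K) (g : GL (Fin (m + 1)) (AdeleRing (𝓞 K) K)),
      ‖W (Matrix.GeneralLinearGroup.scalar (Fin (m + 1)) z * g)‖ = ‖W g‖)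
    {S' : Set (HeightOneSpectrum (𝓞 K))}
    {ϖ : ∀ v : HeightOneSpectrum (𝓞 K), (v.adicCompletion K)ˣ}
    {x : HeightOneSpectrum (𝓞 K) → Fin (m + 1) → ℂ} {y : HeightOneSpectrum (𝓞 K) → Fin m → ℂ}
    (hW : ∀ v ∉ S', IsTorusUnramifiedAt (m + 1) K W v (ϖ v) (x v))
    (hW' : ∀ v ∉ S', IsTorusUnramifiedAt m K W' v (ϖ v) (y v))
    (hxb : ∀ v ∉ S', ∀ i, ‖x v i‖ ≤ (v.residueCard : ℝ) ^ (1 / 2 : ℝ))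
    (hyb : ∀ v ∉ S', ∀ a, ‖y v a‖ ≤ (v.residueCard : ℝ) ^ (1 / 2 : ℝ))
    {s : ℂ} (hs : 1 / 2 < s.re)
    (hint : Integrable (torusPairIntegrandC m K
      (fun g => W (glCorner (AdeleRing (𝓞 K) K) (Nat.le_succ m) g)) W' (fun _ => (1 : ℝ)) s) (νA.prod νK))
    {α β : HeightOneSpectrum (𝓞 K) → Multiset ℂ}
    (hx : ∀ v ∉ S', (Finset.univ : Finset (Fin (m + 1))).val.map (x v) = α v)
    (hy : ∀ v ∉ S', (Finset.univ : Finset (Fin m)).val.map (y v) = β v)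
    (F : Finset {v : HeightOneSpectrum (𝓞 K) // v ∉ S'}) :
    (∏ u ∈ F, ((satakePairPolynomial (α u.1) (β u.1)).eval ((u.1.residueCard : ℂ) ^ (-(s + 1 / 2))))⁻¹) *
      ∫ p in unitBox (↑(F.map (Function.Embedding.subtype fun v => v ∉ S')) : Set (HeightOneSpectrum (𝓞 K))) ×ˢ
          Set.univ, torusPairIntegrandC m K
        (fun g => W (glCorner (AdeleRing (𝓞 K) K) (Nat.le_succ m) g)) W' (fun _ => (1 : ℝ)) s p ∂(νA.prod νK) =
    ∫ p, torusPairIntegrandC m K (fun g => W (glCorner (AdeleRing (𝓞 K) K) (Nat.le_succ m) g)) W'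
        (fun _ => (1 : ℝ)) s p ∂(νA.prod νK) := by
  have hmem : ∀ v ∈ F.map (Function.Embedding.subtype fun v => v ∉ S'), v ∉ S' := fun v hv => by
    obtain ⟨u, -, rfl⟩ := Finset.mem_map.1 hv
    exact u.2
  rw [← CornerPairEuler.stub_corner_euler hm νA νK hWc hW'c hWZ (F.map (Function.Embedding.subtype fun v => v ∉ S'))
    (fun v hv => hW v (hmem v hv)) (fun v hv => hW' v (hmem v hv)) (fun v hv => hxb v (hmem v hv))
    (fun v hv => hyb v (hmem v hv)) s hs hint, Finset.prod_map]
  congr 1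
  refine Finset.prod_congr rfl fun u _ => ?_
  rw [Function.Embedding.coe_subtype, ← hx u.1 u.2, ← hy u.1 u.2]

/-! ### The limit along the finite subsets of `{v ∉ S'}` -/

/-- **The Euler factorisation of the unfolded corner integral over ALL good places** (parametrised form of
`stub_corner_euler_limit`): with the hypotheses there and `L` the product of the local factors
`P_{α_v, β_v}(q_v^{-(s+1/2)})⁻¹` over `v ∉ S'`, `∫ I_s = L · ∫_{B({v ∉ S'}) × K} I_s` — the finite identity
`prod_inv_eval_satakePairPolynomial_mul_setIntegral_image_eq` along `F → {v ∉ S'}`: the finite products tend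
to `L` (`HasProd`), the box integrals to `∫_{B({v ∉ S'}) × K} I_s` (`tendsto_setIntegral_unitBox_image_pair`), and
the left side is constant. [cite: JacquetShalikaAJM1981, §2 Prop. (2.3), §4]
[cite: CogdellAnalyticTheory2004, Thm. 2.2, Thm. 3.3] -/
theorem integral_eq_mul_setIntegral_of_hasProd (hm : 0 < m)
    (νA : Measure (Fin m → ideleGroup K)) [IsHaarMeasure νA]
    (νK : Measure ↥(maximalCompactAdelic m K)) [IsHaarMeasure νK]
    {W : GL (Fin (m + 1)) (AdeleRing (𝓞 K) K) → ℂ} {W' : GL (Fin m) (AdeleRing (𝓞 K) K) → ℂ}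
    (hWc : Continuous W) (hW'c : Continuous W')
    (hWZ : ∀ (z : ideleGroup K) (g : GL (Fin (m + 1)) (AdeleRing (𝓞 K) K)),
      ‖W (Matrix.GeneralLinearGroup.scalar (Fin (m + 1)) z * g)‖ = ‖W g‖)
    {S' : Set (HeightOneSpectrum (𝓞 K))}
    {ϖ : ∀ v : HeightOneSpectrum (𝓞 K), (v.adicCompletion K)ˣ}
    {x : HeightOneSpectrum (𝓞 K) → Fin (m + 1) → ℂ} {y : HeightOneSpectrum (𝓞 K) → Fin m → ℂ}
    (hW : ∀ v ∉ S', IsTorusUnramifiedAt (m + 1) K W v (ϖ v) (x v))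
    (hW' : ∀ v ∉ S', IsTorusUnramifiedAt m K W' v (ϖ v) (y v))
    (hxb : ∀ v ∉ S', ∀ i, ‖x v i‖ ≤ (v.residueCard : ℝ) ^ (1 / 2 : ℝ))
    (hyb : ∀ v ∉ S', ∀ a, ‖y v a‖ ≤ (v.residueCard : ℝ) ^ (1 / 2 : ℝ))
    {s : ℂ} (hs : 1 / 2 < s.re)
    (hint : Integrable (torusPairIntegrandC m K
      (fun g => W (glCorner (AdeleRing (𝓞 K) K) (Nat.le_succ m) g)) W' (fun _ => (1 : ℝ)) s) (νA.prod νK))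
    {α β : HeightOneSpectrum (𝓞 K) → Multiset ℂ}
    (hx : ∀ v ∉ S', (Finset.univ : Finset (Fin (m + 1))).val.map (x v) = α v)
    (hy : ∀ v ∉ S', (Finset.univ : Finset (Fin m)).val.map (y v) = β v)
    {L : ℂ} (hL : HasProd (fun u : {v : HeightOneSpectrum (𝓞 K) // v ∉ S'} =>
      ((satakePairPolynomial (α u.1) (β u.1)).eval ((u.1.residueCard : ℂ) ^ (-(s + 1 / 2))))⁻¹) L) :
    ∫ p, torusPairIntegrandC m K (fun g => W (glCorner (AdeleRing (𝓞 K) K) (Nat.le_succ m) g)) W'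
        (fun _ => (1 : ℝ)) s p ∂(νA.prod νK) =
      L * ∫ p in unitBox {v | v ∉ S'} ×ˢ Set.univ, torusPairIntegrandC m K
        (fun g => W (glCorner (AdeleRing (𝓞 K) K) (Nat.le_succ m) g)) W' (fun _ => (1 : ℝ)) s p
        ∂(νA.prod νK) := by
  have hlim : Tendsto (fun F : Finset {v : HeightOneSpectrum (𝓞 K) // v ∉ S'} =>
      (∏ u ∈ F, ((satakePairPolynomial (α u.1) (β u.1)).eval ((u.1.residueCard : ℂ) ^ (-(s + 1 / 2))))⁻¹) *
        ∫ p in unitBox (↑(F.map (Function.Embedding.subtype fun v => v ∉ S')) : Set (HeightOneSpectrum (𝓞 K))) ×ˢ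
            Set.univ, torusPairIntegrandC m K
          (fun g => W (glCorner (AdeleRing (𝓞 K) K) (Nat.le_succ m) g)) W' (fun _ => (1 : ℝ)) s p ∂(νA.prod νK))
      atTop (𝓝 (L * ∫ p in unitBox {v | v ∉ S'} ×ˢ Set.univ, torusPairIntegrandC m K
        (fun g => W (glCorner (AdeleRing (𝓞 K) K) (Nat.le_succ m) g)) W' (fun _ => (1 : ℝ)) s p ∂(νA.prod νK))) :=
    Filter.Tendsto.mul hL (tendsto_setIntegral_unitBox_image_pair νA νK S' hint)
  simp_rw [prod_inv_eval_satakePairPolynomial_mul_setIntegral_image_eq hm νA νK hWc hW'c hWZ hW hW' hxb hyb hs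
    hint hx hy] at hlim
  exact tendsto_nhds_unique tendsto_const_nhds hlim

/-! ### The registered stub -/

/-- **W-EL — the Euler factorisation of the unfolded `GL_{m+1} × GL_m` corner integral over ALL good
places** (Jacquet–Shalika (1981), §2 Prop. (2.3), §4; Cogdell (2004), Thm. 2.2 with Thm. 3.3): the corner
analogue of `rankinSelbergTorusPairIntegralC_eq_mul_setIntegral_of_hasProd`. For continuous `W` on
`GL_{m+1}(𝔸_K)` (`‖W‖` central-invariant) and `W'` on `GL_m(𝔸_K)`, unramified Whittaker–Hecke torus data at
every `v ∉ S'` with parameters `x_v`, `y_v` bounded by `q_v^{1/2}` and enumerating `α_v`, `β_v`, an integrable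
corner pair integrand `I_s` (`re s > 1/2`), and `L` the product of the local factors `P_{α_v, β_v}(q_v^{-(s+1/2)})⁻¹`
over `v ∉ S'`: `∫ I_s = L · ∫_{B({v ∉ S'}) × K} I_s` (`integral_eq_mul_setIntegral_of_hasProd`).
[cite: JacquetShalikaAJM1981, §2 Prop. (2.3), §4] [cite: CogdellAnalyticTheory2004, Thm. 2.2, Thm. 3.3] -/
theorem stub_corner_euler_limit :
    ∀ {m : ℕ} {K : Type} [Field K] [NumberField K]
      [MeasurableSpace (AdeleRing (𝓞 K) K)] [BorelSpace (AdeleRing (𝓞 K) K)] (_hm : 0 < m)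
      (νA : Measure (Fin m → ideleGroup K)) [IsHaarMeasure νA]
      (νK : Measure ↥(maximalCompactAdelic m K)) [IsHaarMeasure νK]
      {W : GL (Fin (m + 1)) (AdeleRing (𝓞 K) K) → ℂ} {W' : GL (Fin m) (AdeleRing (𝓞 K) K) → ℂ},
      Continuous W → Continuous W' →
      (∀ (z : ideleGroup K) (g : GL (Fin (m + 1)) (AdeleRing (𝓞 K) K)),
        ‖W (Matrix.GeneralLinearGroup.scalar (Fin (m + 1)) z * g)‖ = ‖W g‖) →
      ∀ {S' : Set (HeightOneSpectrum (𝓞 K))}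
        {ϖ : ∀ v : HeightOneSpectrum (𝓞 K), (v.adicCompletion K)ˣ}
        {x : HeightOneSpectrum (𝓞 K) → Fin (m + 1) → ℂ} {y : HeightOneSpectrum (𝓞 K) → Fin m → ℂ},
      (∀ v ∉ S', IsTorusUnramifiedAt (m + 1) K W v (ϖ v) (x v)) →
      (∀ v ∉ S', IsTorusUnramifiedAt m K W' v (ϖ v) (y v)) →
      (∀ v ∉ S', ∀ i, ‖x v i‖ ≤ (v.residueCard : ℝ) ^ (1 / 2 : ℝ)) →
      (∀ v ∉ S', ∀ a, ‖y v a‖ ≤ (v.residueCard : ℝ) ^ (1 / 2 : ℝ)) →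
      ∀ (s : ℂ), 1 / 2 < s.re →
      Integrable (torusPairIntegrandC m K
        (fun g => W (glCorner (AdeleRing (𝓞 K) K) (Nat.le_succ m) g)) W' (fun _ => (1 : ℝ)) s) (νA.prod νK) →
      ∀ {α β : HeightOneSpectrum (𝓞 K) → Multiset ℂ},
      (∀ v ∉ S', (Finset.univ : Finset (Fin (m + 1))).val.map (x v) = α v) →
      (∀ v ∉ S', (Finset.univ : Finset (Fin m)).val.map (y v) = β v) →
      ∀ {L : ℂ}, HasProd (fun u : {v : HeightOneSpectrum (𝓞 K) // v ∉ S'} =>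
        ((satakePairPolynomial (α u.1) (β u.1)).eval ((u.1.residueCard : ℂ) ^ (-(s + 1 / 2))))⁻¹) L →
      ∫ p, torusPairIntegrandC m K (fun g => W (glCorner (AdeleRing (𝓞 K) K) (Nat.le_succ m) g)) W'
          (fun _ => (1 : ℝ)) s p ∂(νA.prod νK) =
        L * ∫ p in unitBox {v | v ∉ S'} ×ˢ Set.univ, torusPairIntegrandC m K
          (fun g => W (glCorner (AdeleRing (𝓞 K) K) (Nat.le_succ m) g)) W' (fun _ => (1 : ℝ)) s p
          ∂(νA.prod νK) := by
  intro m K _ _ _ _ hm νA _ νK _ W W' hWc hW'c hWZ S' ϖ x y hW hW' hxb hyb s hs hint α β hx hy L hL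
  exact integral_eq_mul_setIntegral_of_hasProd hm νA νK hWc hW'c hWZ hW hW' hxb hyb hs hint hx hy hL

end Summit.Langlands.Langlands.Theorems.CornerEulerLimit

end
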